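import Literature.NumberTheory.Rogawski1990.KottwitzSignTwistedFrame
import Literature.NumberTheory.Automorphic.ArchExpIdeleGLOne
import Literature.NumberTheory.QuadraticForms.HermitianCongruenceOfLocalNorms
import Literature.NumberTheory.Rogawski1990.SingularLocalConjugacyArch
import HarnessLib

/-!
# Kottwitz signs, XI: the FRAMED ARCHIMEDEAN READING of the sign of an adelic conjugate at a complex place, and the archimedean norm dictionary
# (Rogawski 1990, §3.8 Prop. 3.8.1 (d) p. 37, §4.1 (4.1.2) pp. 39–40, §8.2 p. 117; Kottwitz 1986 §9)

Topic `NumberTheory/Rogawski1990`; namespace `Literature.NumberTheory.Rogawski1990`.  THEOREMS ONLY (no definition, no named fact, no instance,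
no notation, no `sorry`).  Cell `pub/hodgecm-mathlib`, ENGINE T1 (crux H413 = `stmt-HodgeConjecture-24833`), row O7 «singular semisimple classes»,
O7 OWNER WORDS #43∕#46 row (d) «THE SIGN WEIGHT READS THE OBSTRUCTION» (FILE 1 = this trilogy `KottwitzSignTwistedFrame` ∕ `…Arch` ∕ `KottwitzSignLocalFlip`;
FILE 2 `KottwitzSignReadsObs` (A-p18) assembles the two flips with ★ `MatchingAdeleG₂.singularObs_eq_quadraticArtinIndicator` and ★
`quadraticArtinIndicator_eq_natCast_ncard`).  HC_CM is proved only modulo the printed citations until rung 0 closes; nothing printed is consumed here.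

* §4 **`kottwitzSignAt_archPart_eq_neg_one_iff_of_frame`** — the `∞`-twin of ★ `kottwitzSignLocal_toLocal_eq_neg_one_iff_of_frame` over the field `ℂ`
  (`φ_w = ev_w ∘ π_∞ : 𝔸_L → ℂ`, `σ = conj`): `e_w(p) = −1 ↔ −φ_w((d₀d₁ ⊗ 1) · adelicBlockDet γ₀ a b g)` is not of the form `z z̄`.
* §5 the archimedean dictionary: **`mem_quadraticNormSubgroup_completion_iff_pos`** (at a real place `w₀` of `L⁺`, `θ < 0`: `t ∈ quadraticNormSubgroup ↔ 0 < t`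
  in `L⁺_{w₀} ≅ ℝ`), **`evalC_ringEquiv_mixedSpace_ideleBaseChange`** (`ev_w(π_∞(W ⊗ 1)) = ι(W_{w|L⁺}) ∈ ℝ ⊂ ℂ`, ★ `extensionEmbedding_ideleBaseChange_fst_apply`).

## References
* [Rogawski1990] J. D. Rogawski, *Automorphic Representations of Unitary Groups in Three Variables*, Ann. of Math. Stud. 123 (1990), §3.3 (3.3.1) p. 22;
  §3.8 Prop. 3.8.1 (a)(d) p. 37; §4.1 (4.1.2) pp. 39–40; §8.2 p. 117.
* [Kottwitz1983] R. E. Kottwitz, *Sign changes in harmonic analysis on reductive groups*, Trans. AMS 278 (1983), 289–297.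
* [Kottwitz1986] R. E. Kottwitz, *Stable trace formula: elliptic singular terms*, Math. Ann. 275 (1986), §7 Prop. 7.1, §9.
* [Omeara1963] O. T. O'Meara, *Introduction to Quadratic Forms* (1963), §63B, §65A Example 65:2.
* [CasselsFrohlichANT1967] Cassels–Fröhlich (eds.), *Algebraic Number Theory* (1967), Ch. II §10, Ch. VII Prop. 1.2.
-/

set_option autoImplicit false

noncomputable section

open NumberField NumberField.InfinitePlace IsDedekindDomain Matrix
open scoped MatrixGroups

namespace Literature.NumberTheory.Rogawski1990

open Literature.NumberTheory.Automorphic Literature.NumberTheory.Automorphic.UnitaryGroup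
open Literature.NumberTheory.GaloisRepresentations Literature.NumberTheory.QuadraticForms
open Literature.AlgebraicGeometry.ShimuraVarieties (unitaryGroup hermForm)

section LettersArch

variable {S : Type*} [CommRing S] {N₁ N₂ : ℕ}

/-- `(A ⊕ᶠ B)(C ⊕ᶠ D) = AC ⊕ᶠ BD`. [folklore] -/
private theorem finSum_mul_finSum₅ (A C : Matrix (Fin N₁) (Fin N₁) S) (B D : Matrix (Fin N₂) (Fin N₂) S) :
    finSum N₁ N₂ A B * finSum N₁ N₂ C D = finSum N₁ N₂ (A * C) (B * D) := by
  simp only [finSum, Matrix.reindex_apply, Matrix.submatrix_mul_equiv, Matrix.fromBlocks_multiply, Matrix.mul_zero, Matrix.zero_mul,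
    add_zero, zero_add]

/-- `det (A ⊕ᶠ B) = det A · det B`. [folklore] -/
private theorem det_finSum₅ (A : Matrix (Fin N₁) (Fin N₁) S) (B : Matrix (Fin N₂) (Fin N₂) S) : (finSum N₁ N₂ A B).det = A.det * B.det := by
  rw [finSum, Matrix.det_reindex_self, Matrix.det_fromBlocks_zero₂₁]

/-- `⊕ᶠ` is injective in the pair of blocks. [folklore] -/
private theorem finSum_injective₅ {A C : Matrix (Fin N₁) (Fin N₁) S} {B D : Matrix (Fin N₂) (Fin N₂) S} (h : finSum N₁ N₂ A B = finSum N₁ N₂ C D) :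
    A = C ∧ B = D := by
  have h' := (Matrix.reindex finSumFinEquiv finSumFinEquiv).injective h
  rw [Matrix.fromBlocks_inj] at h'
  exact ⟨h'.1, h'.2.2.2⟩

/-- `ᵗ(σ(A ⊕ᶠ B)) = ᵗ(σA) ⊕ᶠ ᵗ(σB)`. [folklore] -/
private theorem finSum_conjTranspose₅ (σ : S →+* S) (A : Matrix (Fin N₁) (Fin N₁) S) (B : Matrix (Fin N₂) (Fin N₂) S) :
    ((finSum N₁ N₂ A B).map σ)ᵀ = finSum N₁ N₂ ((A.map σ)ᵀ) ((B.map σ)ᵀ) := by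
  rw [finSum_map]
  simp only [finSum, Matrix.reindex_apply, Matrix.transpose_submatrix, Matrix.fromBlocks_transpose, Matrix.transpose_zero]

/-- `diag(d) = diag(d₀, d₁) ⊕ᶠ diag(d₂)`. [folklore] -/
private theorem diagonal_eq_finSum₅ {S : Type*} [CommRing S] (d : Fin 3 → S) :
    Matrix.diagonal d = finSum 2 1 (Matrix.diagonal ![d 0, d 1]) (Matrix.diagonal ![d 2]) := by
  rw [finSum_diagonal_eq_diagonal]
  congr 1
  funext i; fin_cases i <;> rfl

end LettersArch

/-! ## §4 The archimedean flip `e_w(q) = e_w(γ₀ ⊗ 1) · χ_w(W_w)` at a complex place `w` of `L` -/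

section ArchFrame

variable {L : Type} [Field L] [NumberField L] [IsCMField L] {H : Matrix (Fin 3) (Fin 3) L} {γ₀ : (UnitaryGroup.cmDatum L 3 H).Rational}

/-- **THE FRAMED ARCHIMEDEAN READING at a complex place `w` of `L`**: with the letters of §2 and `φ_w = ev_w ∘ π_∞ : 𝔸_L → ℂ`,
`e_w(p) = −1` iff `−φ_w((d₀d₁ ⊗ 1) · adelicBlockDet γ₀ a b g)` is NOT of the form `z z̄` (i.e. is a negative real).  Route: as §2, over the field `ℂ`
with `σ = conj` (★ `kottwitzSign_conj_eq_twistGram`, ★ `exists_twistGram_frame_eq_finSum`, ★ `blockDet_lagrangeIdem_eq_det`, ★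
`kottwitzSign_eq_neg_one_iff_of_frame_finSum`). [cite: Rogawski1990, §3.8 Prop. 3.8.1 (d) p. 37; §4.1 (4.1.2) pp. 39–40; §8.2 p. 117] [cite: Kottwitz1986, §9] -/
theorem kottwitzSignAt_archPart_eq_neg_one_iff_of_frame (hH : (H.map (cmConjRingHom L))ᵀ = H) (hHd : H.det ≠ 0) {a b : L} (hab : a ≠ b)
    {P : GL (Fin 3) L} {d : Fin 3 → L}
    (hP : (((P : Matrix (Fin 3) (Fin 3) L)).map (cmConjRingHom L))ᵀ * H * (P : Matrix (Fin 3) (Fin 3) L) = Matrix.diagonal d)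
    (hγP : (((γ₀ : unitaryGroup (cmConjRingHom L) H).val : GL (Fin 3) L).val : Matrix (Fin 3) (Fin 3) L) * (P : Matrix (Fin 3) (Fin 3) L) =
      (P : Matrix (Fin 3) (Fin 3) L) * finSum 2 1 (a • (1 : Matrix (Fin 2) (Fin 2) L)) (b • (1 : Matrix (Fin 1) (Fin 1) L)))
    (p : MatchingAdeleG₂ L H H γ₀) {g : GL (Fin 3) (AdeleRing (𝓞 L) L)}
    (hg : g * (((UnitaryGroup.cmDatum L 3 H).toAdelic γ₀).val : GL (Fin 3) (AdeleRing (𝓞 L) L)) * g⁻¹ = (p.adele.val : GL (Fin 3) (AdeleRing (𝓞 L) L)))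
    (w : {w : InfinitePlace L // IsComplex w}) :
    kottwitzSignAt L 3 H w (UnitaryGroup.archPart (↥(maximalRealSubfield L)) L (IsCMField.complexConj L) 3 H p.adele) = -1 ↔
      ¬ ∃ z : ℂ, z * starRingEnd ℂ z =
        -(((UnitaryGroup.evalC L w).comp ((InfiniteAdeleRing.ringEquiv_mixedSpace L).toRingHom.comp (UnitaryGroup.adeleFst L)))
            (algebraMap L (AdeleRing (𝓞 L) L) (d 0 * d 1) * adelicBlockDet γ₀ a b g)) := by
  classical
  -- LETTERS at `w`
  set 𝔸 := AdeleRing (𝓞 L) L with h𝔸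
  set πinf : 𝔸 →+* NumberField.mixedEmbedding.mixedSpace L := (InfiniteAdeleRing.ringEquiv_mixedSpace L).toRingHom.comp (UnitaryGroup.adeleFst L)
    with hπinf
  set φ : 𝔸 →+* ℂ := (UnitaryGroup.evalC L w).comp πinf with hφdef
  set σv : ℂ →+* ℂ := starRingEnd ℂ with hσv
  set F : L →+* ℂ := φ.comp (algebraMap L 𝔸) with hFdef
  have hc1 : IsCMField.complexConj L ≠ 1 := IsCMField.complexConj_ne_one L
  have hfix : ∀ w' : InfinitePlace L, IsCMField.complexConj L • w' = w' := UnitaryGroup.complexConj_smul_infinitePlace L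
  have hFemb : ∀ r : L, F r = w.1.embedding r := fun r => by
    show UnitaryGroup.evalC L w (InfiniteAdeleRing.ringEquiv_mixedSpace L (UnitaryGroup.adeleFst L (algebraMap L 𝔸 r))) = _
    rw [show UnitaryGroup.adeleFst L (algebraMap L 𝔸 r) = (algebraMap L 𝔸 r).1 from rfl, QuadraticForms.ringEquiv_mixedSpace_fst_algebraMap,
      UnitaryGroup.evalC_apply, NumberField.mixedEmbedding.mixedEmbedding_apply_isComplex]
  have hF : ∀ r : L, F (cmConjRingHom L r) = σv (F r) := fun r => by
    rw [hFemb, hFemb, cmConjRingHom_apply, IsCMField.complexEmbedding_complexConj]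
  have hφσ : ∀ x : 𝔸, φ (adeleConj L x) = σv (φ x) := fun x => by
    show UnitaryGroup.evalC L w (InfiniteAdeleRing.ringEquiv_mixedSpace L (UnitaryGroup.adeleFst L (adeleConj L x))) =
      starRingEnd ℂ (UnitaryGroup.evalC L w (InfiniteAdeleRing.ringEquiv_mixedSpace L (UnitaryGroup.adeleFst L x)))
    rw [show UnitaryGroup.adeleFst L (adeleConj L x) = (adeleConj L x).1 from rfl, show UnitaryGroup.adeleFst L x = x.1 from rfl,
      QuadraticForms.ringEquiv_mixedSpace_fst_adeleConj, UnitaryGroup.evalC_conjMixed _ L _ (hfix w.1) hc1]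
  have hσσv : ∀ x, σv (σv x) = x := fun x => Complex.conj_conj x
  have hφmap : ∀ M : Matrix (Fin 3) (Fin 3) 𝔸, (M.map πinf).map (UnitaryGroup.evalC L w) = M.map φ := fun M => by
    rw [hφdef, Matrix.map_map]; rfl
  -- make the archimedean letters OPAQUE
  clear_value φ
  -- names for the mapped objects
  set Hv : Matrix (Fin 3) (Fin 3) ℂ := (H.map (algebraMap L 𝔸)).map φ with hHv
  have hHvF : Hv = H.map F := by rw [hHv, Matrix.map_map]; rfl
  set Pv : GL (Fin 3) ℂ := Matrix.GeneralLinearGroup.map F P with hPvdef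
  have hPv : Pv.val = (P : Matrix (Fin 3) (Fin 3) L).map F := rfl
  set γ𝔸 : GL (Fin 3) 𝔸 := ((UnitaryGroup.cmDatum L 3 H).toAdelic γ₀).val with hγ𝔸
  have hγ𝔸val : (γ𝔸 : Matrix (Fin 3) (Fin 3) 𝔸) = ((((γ₀ : unitaryGroup (cmConjRingHom L) H).val : GL (Fin 3) L) : Matrix (Fin 3) (Fin 3) L)).map
      (algebraMap L 𝔸) := by
    rw [hγ𝔸, UnitaryGroup.coe_cmDatum_toAdelic, val_toAdeleGL]
  set γv : GL (Fin 3) ℂ := Matrix.GeneralLinearGroup.map φ γ𝔸 with hγvdef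
  have hγvval : γv.val = (γ𝔸 : Matrix (Fin 3) (Fin 3) 𝔸).map φ := rfl
  have hγvF : γv.val = ((((γ₀ : unitaryGroup (cmConjRingHom L) H).val : GL (Fin 3) L) : Matrix (Fin 3) (Fin 3) L)).map F := by
    rw [hγvval, hγ𝔸val, Matrix.map_map]; rfl
  set gv : GL (Fin 3) ℂ := Matrix.GeneralLinearGroup.map φ g with hgvdef
  have hgvval : gv.val = (g : Matrix (Fin 3) (Fin 3) 𝔸).map φ := rfl
  set xg : Matrix (Fin 3) (Fin 3) 𝔸 := (H.map (algebraMap L 𝔸))⁻¹ * twistGram (adeleConj L) (H.map (algebraMap L 𝔸)) (g : Matrix (Fin 3) (Fin 3) 𝔸) with hxg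
  set xv : Matrix (Fin 3) (Fin 3) ℂ := xg.map φ with hxvdef
  -- unit determinants
  have hHu : IsUnit H.det := isUnit_iff_ne_zero.mpr hHd
  have hH𝔸u : IsUnit (H.map (algebraMap L 𝔸)).det := isUnit_det_adelicForm hHu
  have hHvd : IsUnit Hv.det := by rw [hHvF, ← RingHom.mapMatrix_apply, ← RingHom.map_det]; exact hHu.map F
  have hFab : IsUnit (F a - F b) := by rw [← map_sub]; exact (IsUnit.mk0 _ (sub_ne_zero.mpr hab)).map F
  -- (0) the coordinate sign is the sign of `(γ₀)_w` for the twisted form `G' = ᵗ(σ g_w) H_w g_w`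
  set G' : Matrix (Fin 3) (Fin 3) ℂ := twistGram σv Hv gv.val with hG'def
  have hq : ((((UnitaryGroup.archPart (↥(maximalRealSubfield L)) L (IsCMField.complexConj L) 3 H p.adele :
        ↥(UnitaryGroup.arch (↥(maximalRealSubfield L)) L (IsCMField.complexConj L) 3 H)) : GL (Fin 3) (NumberField.mixedEmbedding.mixedSpace L)) :
        Matrix (Fin 3) (Fin 3) (NumberField.mixedEmbedding.mixedSpace L)).map (UnitaryGroup.evalC L w)) = (gv * γv * gv⁻¹).val := by
    have h1 : ((UnitaryGroup.archPart (↥(maximalRealSubfield L)) L (IsCMField.complexConj L) 3 H p.adele :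
        ↥(UnitaryGroup.arch (↥(maximalRealSubfield L)) L (IsCMField.complexConj L) 3 H)) : GL (Fin 3) (NumberField.mixedEmbedding.mixedSpace L)) =
        GLn.toMixed 3 L (p.adele.val : GL (Fin 3) 𝔸) := rfl
    have e1 : gv * γv * gv⁻¹ = Matrix.GeneralLinearGroup.map φ (p.adele.val : GL (Fin 3) 𝔸) := by
      rw [← hg, map_mul, map_mul, map_inv]
    rw [e1, h1, toMixed_eq_map]
    exact hφmap _
  have hsign : kottwitzSignAt L 3 H w (UnitaryGroup.archPart (↥(maximalRealSubfield L)) L (IsCMField.complexConj L) 3 H p.adele) =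
      kottwitzSign σv G' γv.val := by
    unfold kottwitzSignAt
    have hHw : H.map w.1.embedding = Hv := by
      rw [hHvF]; exact congrArg H.map (funext fun r => (hFemb r).symm)
    rw [UnitaryGroup.archFormOf_map_evalC, hq, Units.val_mul, Units.val_mul, hHw]
    exact kottwitzSign_conj_eq_twistGram σv Hv gv _
  -- (1) the frame at `w`
  set Ha : Matrix (Fin 2) (Fin 2) L := Matrix.diagonal ![d 0, d 1] with hHa
  set Hb : Matrix (Fin 1) (Fin 1) L := Matrix.diagonal ![d 2] with hHb
  have hP' : (((P : Matrix (Fin 3) (Fin 3) L)).map (cmConjRingHom L))ᵀ * H * (P : Matrix (Fin 3) (Fin 3) L) = finSum 2 1 Ha Hb := by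
    rw [hP, diagonal_eq_finSum₅]
  have hPv_frame : twistGram σv Hv Pv.val = finSum 2 1 (Ha.map F) (Hb.map F) := by
    rw [hHvF, hPv, ← twistGram_map (cmConjRingHom L) H σv F hF, twistGram_def, hP', finSum_map]
  have hsmul1 : ∀ (n : ℕ) (c : L), (c • (1 : Matrix (Fin n) (Fin n) L)).map F = F c • (1 : Matrix (Fin n) (Fin n) ℂ) :=
    fun n c => by rw [Matrix.map_smul' _ _ _ (map_mul F), Matrix.map_one _ (map_zero F) (map_one F)]
  have hγv_frame : γv.val * Pv.val = Pv.val * finSum 2 1 (F a • (1 : Matrix (Fin 2) (Fin 2) ℂ)) (F b • (1 : Matrix (Fin 1) (Fin 1) ℂ)) := by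
    rw [hγvF, hPv, ← Matrix.map_mul, hγP, Matrix.map_mul, finSum_map, hsmul1, hsmul1]
  -- (2) `G'` is hermitian, `x_w = Hv⁻¹ G'` commutes with `(γ₀)_w`
  have hσF : (⇑σv ∘ ⇑F : L → ℂ) = ⇑F ∘ ⇑(cmConjRingHom L) := funext fun r => (hF r).symm
  have hσvHv : (Hv.map σv)ᵀ = Hv := by
    rw [hHvF, Matrix.map_map, hσF, ← Matrix.map_map, ← Matrix.transpose_map, hH]
  have hG' : (G'.map σv)ᵀ = G' := conjTranspose_twistGram σv Hv hσσv hσvHv _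
  have hgvd : IsUnit gv.val.det := Matrix.isUnits_det_units gv
  have hG'd : IsUnit G'.det := by
    rw [hG'def, det_twistGram]; exact ((hgvd.map σv).mul hHvd).mul hgvd
  have hxv_eq : xv = Hv⁻¹ * G' := by
    rw [hxvdef, hxg, hG'def, hHv, hgvval, Matrix.map_mul, Literature.LinearAlgebra.Matrix.map_nonsing_inv_of_isUnit _ hH𝔸u,
      twistGram_map (adeleConj L) _ σv φ hφσ]
  have hxv_comm : Hv⁻¹ * G' * γv.val = γv.val * (Hv⁻¹ * G') := by
    rw [← hxv_eq, hxvdef, hγvval, ← Matrix.map_mul, ← Matrix.map_mul]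
    exact congrArg (fun M : Matrix (Fin 3) (Fin 3) 𝔸 => M.map ⇑φ) (commute_adelicCartan hHu p hg).eq
  obtain ⟨y₁, y₂, hG'P⟩ := exists_twistGram_frame_eq_finSum (N₁ := 2) (N₂ := 1) σv hHvd hFab hPv_frame hγv_frame hxv_comm
  change Matrix (Fin 2) (Fin 2) ℂ at y₁
  change twistGram σv G' Pv.val = finSum 2 1 (Ha.map F * y₁) (Hb.map F * y₂) at hG'P
  -- (3) `x_w` in the frame and the plane-block determinant
  have hPu : IsUnit Pv.val.det := Matrix.isUnits_det_units Pv
  have hxvP : xv * Pv.val = Pv.val * finSum 2 1 y₁ y₂ := by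
    have hfu : IsUnit (finSum 2 1 (Ha.map F) (Hb.map F)).det := by
      rw [← hPv_frame, det_twistGram]; exact ((hPu.map σv).mul hHvd).mul hPu
    have h1 : finSum 2 1 (Ha.map F) (Hb.map F) * (Pv.val⁻¹ * xv * Pv.val) = finSum 2 1 (Ha.map F) (Hb.map F) * finSum 2 1 y₁ y₂ := by
      rw [finSum_mul_finSum₅, ← hG'P, ← hPv_frame, twistGram_def, twistGram_def, hxv_eq]
      simp only [Matrix.mul_assoc]
      rw [Matrix.mul_nonsing_inv_cancel_left _ _ hPu, Matrix.mul_nonsing_inv_cancel_left _ _ hHvd]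
    have h2 : Pv.val⁻¹ * xv * Pv.val = finSum 2 1 y₁ y₂ := by
      have h := congrArg (fun M => (finSum 2 1 (Ha.map F) (Hb.map F))⁻¹ * M) h1
      simpa only [← Matrix.mul_assoc, Matrix.nonsing_inv_mul _ hfu, Matrix.one_mul] using h
    rw [← h2, ← Matrix.mul_assoc, ← Matrix.mul_assoc, Matrix.mul_nonsing_inv _ hPu, Matrix.one_mul]
  have hev : (adelicLagrangeIdem γ₀ a b).map ⇑φ = F (a - b)⁻¹ • (γv.val - F b • (1 : Matrix (Fin 3) (Fin 3) ℂ)) := by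
    rw [adelicLagrangeIdem_eq, Matrix.map_smul' _ _ _ (map_mul φ), Matrix.map_sub _ (map_sub φ), Matrix.map_smul' _ _ _ (map_mul φ),
      Matrix.map_one _ (map_zero φ) (map_one φ), hγvval, hγ𝔸]
    rfl
  have hu : F (a - b)⁻¹ * (F a - F b) = 1 := by
    rw [← map_sub, ← map_mul, inv_mul_cancel₀ (sub_ne_zero.2 hab), map_one]
  have hdet₁ : y₁.det = φ (adelicBlockDet γ₀ a b g) := by
    rw [← blockDet_lagrangeIdem_eq_det (N₁ := 2) (N₂ := 1) (P := Pv) hγv_frame hu hxvP, ← hev, hxvdef, hxg, blockDet_map, ← adelicBlockDet_def]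
  have hdetB : (Ha.map F * y₁).det = φ (algebraMap L 𝔸 (d 0 * d 1) * adelicBlockDet γ₀ a b g) := by
    rw [Matrix.det_mul, hdet₁, hHa, Matrix.diagonal_map (map_zero F), Matrix.det_diagonal, map_mul]
    simp only [Fin.prod_univ_two, Matrix.cons_val_zero, Matrix.cons_val_one]
    rw [← map_mul]
    rfl
  -- (4) the blocks of `ᵗ(σP) G' P`: the plane block is hermitian, the line block is non-zero
  have hTh : ((twistGram σv G' Pv.val).map σv)ᵀ = twistGram σv G' Pv.val := conjTranspose_twistGram σv G' hσσv hG' _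
  rw [hG'P, finSum_conjTranspose₅] at hTh
  have hB : ((Ha.map F * y₁).map σv)ᵀ = Ha.map F * y₁ := (finSum_injective₅ hTh).1
  have hTd : IsUnit (twistGram σv G' Pv.val).det := by
    rw [det_twistGram]; exact ((hPu.map σv).mul hG'd).mul hPu
  rw [hG'P, det_finSum₅] at hTd
  have hC : (Hb.map F * y₂) 0 0 ≠ 0 := by
    rw [← Matrix.det_fin_one (Hb.map F * y₂)]
    exact (isUnit_of_mul_isUnit_right hTd).ne_zero
  -- (5) assemble over the field `ℂ`
  have hHP : (Pv.val.map σv)ᵀ * G' * Pv.val = finSum 2 1 (Ha.map F * y₁) (Hb.map F * y₂) := by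
    rw [← hG'P, twistGram_def]
  rw [hsign, kottwitzSign_eq_neg_one_iff_of_frame_finSum σv G' Pv hFab hγv_frame hHP hB hC, hdetB]
  simp_rw [mul_comm (σv _) _]
  exact Iff.rfl

end ArchFrame

section ArchDictionary

variable {L : Type} [Field L] [NumberField L] [IsCMField L]

/-- **Local norms at a REAL place `w₀` of `L⁺` from `L⁺_{w₀}(√θ) = ℂ`** (`θ < 0` at `w₀`): `t ∈ quadraticNormSubgroup (L⁺_{w₀}) θ ↔ 0 < t` in `L⁺_{w₀} ≅ ℝ`
(★ `ringEquivRealOfIsReal`). [cite: Omeara1963, §63B] -/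
theorem mem_quadraticNormSubgroup_completion_iff_pos {w₀ : InfinitePlace ↥(maximalRealSubfield L)} (hw₀ : w₀.IsReal) (t : (w₀.Completion)ˣ) :
    t ∈ quadraticNormSubgroup w₀.Completion (algebraMap (↥(maximalRealSubfield L)) w₀.Completion (cmQuadraticGenerator L : ↥(maximalRealSubfield L))) ↔
      0 < InfinitePlace.Completion.ringEquivRealOfIsReal hw₀ (t : w₀.Completion) := by
  set E := InfinitePlace.Completion.ringEquivRealOfIsReal hw₀ with hE
  have hθ : E (algebraMap (↥(maximalRealSubfield L)) w₀.Completion (cmQuadraticGenerator L : ↥(maximalRealSubfield L))) < 0 := by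
    rw [hE, QuadraticForms.ringEquivRealOfIsReal_algebraMap]
    exact embedding_cmQuadraticGenerator_lt_zero' L w₀ hw₀
  have ht0 : E (t : w₀.Completion) ≠ 0 := (map_ne_zero_iff _ E.injective).2 t.ne_zero
  rw [mem_quadraticNormSubgroup_iff]
  constructor
  · rintro ⟨x, y, hxy⟩
    have h := congrArg E hxy
    rw [map_sub, map_pow, map_mul, map_pow] at h
    rcases lt_or_gt_of_ne ht0 with hlt | hgt
    · exfalso
      have : 0 ≤ E x ^ 2 - E (algebraMap (↥(maximalRealSubfield L)) w₀.Completion ↑(cmQuadraticGenerator L)) * E y ^ 2 := by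
        nlinarith [sq_nonneg (E x), sq_nonneg (E y)]
      linarith
    · exact hgt
  · intro ht
    refine ⟨E.symm (Real.sqrt (E (t : w₀.Completion))), 0, ?_⟩
    apply E.injective
    rw [map_sub, map_pow, map_mul, map_pow, map_zero, E.apply_symm_apply, Real.sq_sqrt ht.le]
    ring

omit [IsCMField L] in
/-- **The `w`-coordinate of the base change of an idèle of `L⁺` is the REAL number `W_{w|L⁺}`**: for a complex place `w` of `L` over the (real) place
`w₀ = w|_{L⁺}`, `ev_w(π_∞(W ⊗ 1)) = ι(W_{w₀}) ∈ ℝ ⊂ ℂ` (★ `extensionEmbedding_ideleBaseChange_fst_apply`; both branches agree on a real coordinate).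
[cite: CasselsFrohlichANT1967, Ch. II §10] -/
theorem evalC_ringEquiv_mixedSpace_ideleBaseChange (w : {w : InfinitePlace L // IsComplex w})
    (W : (AdeleRing (𝓞 ↥(maximalRealSubfield L)) ↥(maximalRealSubfield L))ˣ) :
    ((UnitaryGroup.evalC L w).comp ((InfiniteAdeleRing.ringEquiv_mixedSpace L).toRingHom.comp (UnitaryGroup.adeleFst L)))
        ((AdeleRing.ideleBaseChange (↥(maximalRealSubfield L)) L W : (AdeleRing (𝓞 L) L)ˣ) : AdeleRing (𝓞 L) L) =
      (((InfinitePlace.Completion.ringEquivRealOfIsReal (IsTotallyReal.isReal (w.1.comap (algebraMap (↥(maximalRealSubfield L)) L))))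
          (ideleInfiniteComponent (↥(maximalRealSubfield L)) (w.1.comap (algebraMap (↥(maximalRealSubfield L)) L)) W :
            (w.1.comap (algebraMap (↥(maximalRealSubfield L)) L)).Completion) : ℝ) : ℂ) := by
  set w₀ := w.1.comap (algebraMap (↥(maximalRealSubfield L)) L) with hw₀
  have hreal : InfinitePlace.Completion.extensionEmbedding w₀ ((W : AdeleRing (𝓞 ↥(maximalRealSubfield L)) ↥(maximalRealSubfield L)).1 w₀) =
      (((InfinitePlace.Completion.ringEquivRealOfIsReal (IsTotallyReal.isReal w₀))
          (ideleInfiniteComponent (↥(maximalRealSubfield L)) w₀ W : w₀.Completion) : ℝ) : ℂ) := by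
    rw [val_ideleInfiniteComponent, InfinitePlace.Completion.ringEquivRealOfIsReal_apply, InfinitePlace.Completion.extensionEmbeddingOfIsReal_apply]
  show UnitaryGroup.evalC L w (InfiniteAdeleRing.ringEquiv_mixedSpace L
      (UnitaryGroup.adeleFst L ((AdeleRing.ideleBaseChange (↥(maximalRealSubfield L)) L W : (AdeleRing (𝓞 L) L)ˣ) : AdeleRing (𝓞 L) L))) = _
  rw [show UnitaryGroup.adeleFst L ((AdeleRing.ideleBaseChange (↥(maximalRealSubfield L)) L W : (AdeleRing (𝓞 L) L)ˣ) : AdeleRing (𝓞 L) L) =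
      (((AdeleRing.ideleBaseChange (↥(maximalRealSubfield L)) L W : (AdeleRing (𝓞 L) L)ˣ) : AdeleRing (𝓞 L) L)).1 from rfl,
    UnitaryGroup.evalC_apply, InfiniteAdeleRing.ringEquiv_mixedSpace_apply]
  dsimp only
  rw [extensionEmbedding_ideleBaseChange_fst_apply]
  split_ifs
  · exact hreal
  · rw [← hw₀, hreal, Complex.conj_ofReal]


end ArchDictionary

end Literature.NumberTheory.Rogawski1990

end
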